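import Summits.QuantumFields.YangMills.Theorems.BalabanUVNodesN12SegmentPlaqFamily
import Summits.QuantumFields.YangMills.Theorems.BalabanUVNodesN12IteratedPlaqLetterOfFamily
import Summits.QuantumFields.YangMills.Theorems.BalabanUVNodesN12GaugeLetterLocNumerics
import HarnessLib

/-!
# BalabanUVNodes ∕ N12 — THE SEGMENT PLAQUETTE FAMILY AT THE RECORD's `𝐁_k(Z)`: its base lies in the class region two levels down (the printed collar [III] (2.13) for `i ≥ 3`, the support layer
# of [III] p. 255 for `i ≤ 2`, `M₁ ≥ ((d+4)L+6)·L²`), so the family EXISTS with all three clauses; hence the (σ)_N capstone at the record holds modulo CLASS, DATUM, GEOMETRY LETTERS OF THE REGION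
# (`hGN`, `hN1`, `hGmem`) and NUMERICS only — every plaquette estimate read off [15] (2) ∕ [6] (1.7) and [Balaban1985Averaging] Prop. 2 by name

Cell `pub-ymgap` (HUMAN RULINGS D-0062 ∕ D-0149), WIDTH SEAT `pub-ymgap-dag-n12-w3` g4 (node N12 = [B15]; key K1⁹ `stmt-QuantumFields-27364` (KEY MAP v2), `--kind proof --supports … --as
helper`; count-neutral).  THEOREMS ONLY (0 `def`, 0 `instance`, 0 `sorry`); consumed BY NAME: this lineage's `N12SegmentPlaqFamily` (§1–§2), `N12BjCollarRoots` (the printed collar at the fine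
level), r11's `B14.Eq213DetSet.dist_maxDomT`, NODE 00's `Node00.cover_mem_hullD_one_of_within`, `N12IteratedPlaqLetterOfFamily.exists_gaugeLetterLoc_atRecord_of_class_of_family`,
`N12GaugeLetterLocNumerics.sum_pow_le_two_mul_pow`.

WHY.  `N12IteratedPlaqLetterOfFamily` displays the family `Sfam` with (closed), (base), (need); `N12SegmentPlaqFamily` gives the explicit family
`{q | ∀ ν, ∃ E, |E| ≤ B_{i,j} ∧ (ι_j q₋) ν = (ι_i c₋) ν + E}` with (closed) and (need).  THIS FILE proves (base) at the record: a member `c` of `𝐁_k(Z)_i` (`i ≥ 1`) has an end `y` with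
`ι_i y ∈ Ω_i` and `ι_i c₋` within `Lⁱ` of it; the base box has radius `B_{i,0} + Lⁱ ≤ ((d+4)L+6)·Lⁱ`; for `i ≥ 3` it lies in `Ω_{i−2}` by `dist(Ω_{i−1}, Ω_{i−2}ᶜ) ≥ L^{i−1}M₁`
(`dist_maxDomT`), for `i ≤ 2` in the support `Ω₀ = hullD M₁ 1 Ω₁` (`cover_mem_hullD_one_of_within`) — both under `M₁ ≥ ((d+4)L+6)·L²`.  ★★ `base_subset_topSeq`; ★★★ `exists_segmentPlaqFamily_Bj`
(the family with all three clauses); ★★★ `exists_gaugeLetterLoc_atRecord_of_class_geometry` — the (σ)_N capstone with RESIDUE: the minimiser in NODE 00's class, the region datum `W 𝒞 ρn`, the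
region's geometry letters `hGN` ∕ `hN1` (dag-n12-w6) ∕ `hGmem` (shadows), the tower budgets `θ`, and NUMERICS (`εreg` positive and small, no-wrap, radii, `M₁ ≥ ((d+4)L+6)·L²`, `2 ≤ M₁`, cover
divisibility).  SCALING caveat as in the class edition (scale-0 tolerances are crude; print's per-level scaling needs a graded producer).

HONEST FRAMING.  Lattice bookkeeping + composition by name; the minimiser ([15] Thm 1 ∕ (E)), the region datum, the region geometry letters, the budgets and the numerics stay HYPOTHESES; nothing
of Bałaban's asserted beyond the cited tree theorems; count-neutral; N12 NOT discharged; K1⁹ NOT closed; counts unmoved (typed 28∕28 · discharged 5∕27); one finite 𝕋⁴ programme at fixed ε — R4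
closes the conditional rung `BalabanLadder.UV` only; the Yang–Mills mass gap (Clay) is NOT proved by any of this; nothing continuum ∕ ℝ⁴ ∕ OS.
-/

noncomputable section

open scoped Matrix.Norms.L2Operator BigOperators

namespace Summit.QuantumFields.YangMills.BalabanUVNodes.N12SegmentPlaqFamilyAtRecord

open Literature.MathematicalPhysics.QuantumFieldTheory.Balaban1983to89
open T4Continuum GaugeField B15DeterminingSets BlockAveraging
open T4CubeChartGnomonic (SU2)
open B16Sect1Backgrounds (toMS)
open B14.Eq213MaximalDomains (side)
open B14.Eq213DetSet (Bj Bj_mid Bj_top maxDomT maxDomT_antitone dist_maxDomT)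
open B14.Eq216Concrete (inputs)
open B14.Eq22Determines (blockIter)
open B14DomainGeom (Within)
open B15Eq112TorusCover (cover lift cover_lift cover_apply)
open B5Eq118OneStroke (iterBlockOf)
open B8Eq17ClassAkV1 (plaqsOf)
open ExpMeanLog (deltaSU)
open Literature.MathematicalPhysics.QuantumFieldTheory.BalabanImbrieJaffe1984to88.BIJ85Eq453GaugeField (qsstarGIter0)
open Summit.QuantumFields.YangMills.BalabanUVNodes.N20LCSAvgDominationRegion (boxRegion)
open Summit.QuantumFields.YangMills.BalabanUVNodes.N12BjCollarRoots (mem_maxDomT_pred_of_blockIdx idx_adj_of_bond le_of_iterBlockOf_mem_Bj)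
open Summit.QuantumFields.YangMills.BalabanUVNodes.N12SegmentPlaqFamily
open Summit.QuantumFields.YangMills.BalabanUVNodes.N12GaugeLetterLocNumerics (sum_pow_le_two_mul_pow)
open Summit.QuantumFields.YangMills.BalabanUVNodes.N12IteratedPlaqLetterOfFamily (exists_gaugeLetterLoc_atRecord_of_class_of_family)

variable {P : Params}

/-! ## §1 The base of the family lies in the class region two levels down -/

section Base

/-- A member of `𝐁_k(Z)_i` (`1 ≤ i ≤ k`) has its centre in `Ω_i`. [cite: Balaban1988Convergent, (2.2) p.255, (2.13) pp.256–257] -/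
theorem embIter_mem_maxDomT_of_mem_Bj {M₁ k : ℕ} {Z : Set (Site P 0)} {i : ℕ} (hi1 : 1 ≤ i) (hik : i ≤ k) {y : Site P i}
    (hy : y ∈ (Bj M₁ Z k : DetSet P) i) : embIter i y ∈ maxDomT M₁ Z i := by
  rcases hik.lt_or_eq with hlt | heq
  · rw [Bj_mid hi1 hlt] at hy; exact hy.1
  · subst heq; rw [Bj_top] at hy; exact hy

/-- **A MEMBER's SOURCE CENTRE IS WITHIN `Lⁱ` OF A POINT OF `Ω_i`**: for `c ∈ bondsOf 𝐁_k(Z)_i` (`1 ≤ i ≤ k`), some end `y` of `c` has `ι_i y ∈ Ω_i` and `(ι_i c₋)_ν = (ι_i y)_ν + D_ν`, `|D_ν| ≤ Lⁱ`.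
[cite: Balaban1988Convergent, (2.2) p.255; Balaban1987RG1, (0.1) p.251 (bookkeeping)] -/
theorem exists_anchor_of_mem_bondsOf {M₁ k : ℕ} {Z : Set (Site P 0)} {i : ℕ} (hi1 : 1 ≤ i) (hik : i ≤ k) (hk : k ≤ P.m + P.K) {c : PBond P i}
    (hc : c ∈ bondsOf ((Bj M₁ Z k : DetSet P) i)) :
    ∃ y : Site P 0, y ∈ maxDomT M₁ Z i ∧ ∀ ν, ∃ D : ℤ, |D| ≤ ((P.L ^ i : ℕ) : ℤ) ∧ embIter i c.src ν = y ν + (D : ZMod (P.sitesPerDir 0)) := by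
  rcases hc with h | h
  · exact ⟨embIter i c.src, embIter_mem_maxDomT_of_mem_Bj hi1 hik h, fun ν => ⟨0, by positivity, by simp⟩⟩
  · refine ⟨embIter i c.tgt, embIter_mem_maxDomT_of_mem_Bj hi1 hik h, fun ν => ?_⟩
    -- `ι_i c₊ = ι_i c₋ + Lⁱ·e_dir`
    have htgt : ∀ ν, (c.tgt : Site P i) ν = c.src ν + (((if ν = c.dir then (1 : ℤ) else 0 : ℤ)) : ZMod (P.sitesPerDir i)) := fun ν => by
      show (c.src.shift c.dir) ν = _
      rw [Site.shift_apply]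
      by_cases hν : ν = c.dir
      · subst hν; simp
      · simp [hν]
    have h1 := embIter_apply_of_add (hik.trans hk) c.src c.tgt (fun ν => if ν = c.dir then 1 else 0) htgt ν
    refine ⟨-(if ν = c.dir then ((P.L ^ i : ℕ) : ℤ) else 0), ?_, ?_⟩
    · split_ifs <;> simp
    · rw [h1]
      by_cases hν : ν = c.dir
      · subst hν; simp only [if_true]; push_cast; ring
      · simp only [if_neg hν]; push_cast; ring

/-- ★★ **THE BASE OF THE FAMILY LIES IN THE CLASS REGION TWO LEVELS DOWN.**  At the record (`Ω_n = maxDomT ν.M₁ Z n`, support `Ω₀ = suppDomOfRecord = hullD M₁ 1 Ω₁`), `M₁ ≥ ((d+4)L+6)·L²`, cover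
divisibility at level `k ≤ m + K`: for a member `c` of `𝐁_k(Z)_i` (`1 ≤ i ≤ k`) every fine plaquette `q` with `(q₋)_ν = (ι_i c₋)_ν + E_ν`, `|E_ν| ≤ B_{i,0} = 3·Lⁱ + ((d+4)L+2)·Σ_{l<i} Lˡ`, has its source in
`topSeq Ω₀ Ω (i − 2)` — `Ω_{i−2}` for `i ≥ 3` (the printed collar from a point of `Ω_i ⊆ Ω_{i−1}`), the support `Ω₀` for `i ≤ 2` (one layer of `M₁`-cubes around `Ω₁`).
[cite: Balaban1988Convergent, p.255 («support»), (2.13) pp.256–257; Balaban1985Variational, (2) p.278; Balaban1985RegularSpaces, (1.7) p.77] -/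
theorem base_subset_topSeq {F : T4Family} (ν₀ : Node00.Stage7Numerics) (Kt : ℕ) {k : ℕ} (hk : k ≤ (F.P Kt).m + (F.P Kt).K)
    (hM₁ : (((F.P Kt).d + 4) * (F.P Kt).L + 6) * (F.P Kt).L ^ 2 ≤ ν₀.M₁) (hdiv : side (F.P Kt).L ν₀.M₁ k ∣ (F.P Kt).sitesPerDir 0) (Z : Set (Site (F.P Kt) 0))
    {i : ℕ} (hi1 : 1 ≤ i) (hik : i ≤ k) {c : PBond (F.P Kt) i} (hc : c ∈ bondsOf ((Bj ν₀.M₁ Z k : DetSet (F.P Kt)) i))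
    {q : Plaq (F.P Kt) 0}
    (hq : ∀ ν, ∃ E : ℤ, |E| ≤ ((3 * (F.P Kt).L ^ i + (((F.P Kt).d + 4) * (F.P Kt).L + 2) * ∑ l ∈ Finset.Ico 0 i, (F.P Kt).L ^ l : ℕ) : ℤ) ∧
      embIter 0 q.src ν = embIter i c.src ν + (E : ZMod ((F.P Kt).sitesPerDir 0))) :
    q ∈ plaqsOf (Node00.topSeq (Node00.suppDomOfRecord F ν₀ Kt (maxDomT ν₀.M₁ Z)) (maxDomT ν₀.M₁ Z) (i - 2)) := by
  classical
  have hL2 : 2 ≤ (F.P Kt).L := (F.P Kt).hL.2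
  have hLpos : 0 < (F.P Kt).L := (F.P Kt).L_pos
  -- abbreviations for the numerics
  obtain ⟨n, rfl⟩ : ∃ n, i = n + 1 := ⟨i - 1, by omega⟩
  have hLn : 1 ≤ (F.P Kt).L ^ n := Nat.one_le_pow n _ hLpos
  have hsumle : ∑ l ∈ Finset.Ico 0 (n + 1), (F.P Kt).L ^ l ≤ (F.P Kt).L ^ (n + 1) := by
    rw [Nat.Ico_zero_eq_range]
    have h := sum_pow_le_two_mul_pow hL2 n
    rw [pow_succ]
    nlinarith
  have hM : 1 ≤ ν₀.M₁ := by
    have : 0 < (((F.P Kt).d + 4) * (F.P Kt).L + 6) * (F.P Kt).L ^ 2 := by positivity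
    omega
  -- the anchor in `Ω_i` and the total offset
  obtain ⟨y, hyΩ, hD⟩ := exists_anchor_of_mem_bondsOf hi1 hik hk hc
  choose E hE hqE using hq
  choose D hDle hyD using hD
  -- the radius `R = B_{i,0} + Lⁱ ≤ ((d+4)L + 6)·Lⁱ`
  have hR : (3 * (F.P Kt).L ^ (n + 1) + (((F.P Kt).d + 4) * (F.P Kt).L + 2) * ∑ l ∈ Finset.Ico 0 (n + 1), (F.P Kt).L ^ l) + (F.P Kt).L ^ (n + 1) ≤
      (((F.P Kt).d + 4) * (F.P Kt).L + 6) * (F.P Kt).L ^ (n + 1) := by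
    have := Nat.mul_le_mul_left (((F.P Kt).d + 4) * (F.P Kt).L + 2) hsumle
    nlinarith
  have hV : ∀ κ, |E κ + D κ| ≤ (((((F.P Kt).d + 4) * (F.P Kt).L + 6) * (F.P Kt).L ^ (n + 1) : ℕ) : ℤ) := fun κ => by
    have h1 := hE κ
    have h2 := hDle κ
    have h3 := abs_add_le (E κ) (D κ)
    have hR' : (((3 * (F.P Kt).L ^ (n + 1) + (((F.P Kt).d + 4) * (F.P Kt).L + 2) * ∑ l ∈ Finset.Ico 0 (n + 1), (F.P Kt).L ^ l : ℕ) : ℤ)) + ((F.P Kt).L ^ (n + 1) : ℕ) ≤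
        (((((F.P Kt).d + 4) * (F.P Kt).L + 6) * (F.P Kt).L ^ (n + 1) : ℕ) : ℤ) := by exact_mod_cast hR
    linarith
  -- `q₋ = cover (lift y + (E + D))`
  have hsrc : q.src = cover (F.P Kt) (lift (F.P Kt) y + fun κ => E κ + D κ) := by
    funext κ
    have h := hqE κ
    rw [hyD κ] at h
    rw [cover_apply, Pi.add_apply]
    show q.src κ = _
    have h' : (embIter 0 q.src) κ = q.src κ := rfl
    rw [← h', h]
    simp only [lift]
    push_cast
    rw [ZMod.natCast_zmod_val]
    ring
  have hwithin : ∀ κ, |(lift (F.P Kt) y + fun κ => E κ + D κ) κ - lift (F.P Kt) y κ| ≤ (((((F.P Kt).d + 4) * (F.P Kt).L + 6) * (F.P Kt).L ^ (n + 1) : ℕ) : ℤ) := fun κ => by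
    simp only [Pi.add_apply, add_sub_cancel_left]
    exact hV κ
  -- membership of the source in `topSeq Ω₀ Ω (i − 2)`
  refine Or.inl ?_
  rw [hsrc]
  rcases Nat.lt_or_ge (n + 1) 3 with hsmall | hbig
  · -- `i ≤ 2`: the support layer around `Ω₁`
    have htop : Node00.topSeq (Node00.suppDomOfRecord F ν₀ Kt (maxDomT ν₀.M₁ Z)) (maxDomT ν₀.M₁ Z) (n + 1 - 2) =
        Node00.hullD (F.P Kt) ν₀.M₁ 1 (maxDomT ν₀.M₁ Z 1) := by
      have h0 : n + 1 - 2 = 0 := by omega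
      rw [h0, Node00.topSeq_zero]; rfl
    rw [htop]
    have hy1 : y ∈ maxDomT ν₀.M₁ Z 1 := maxDomT_antitone hM Z hi1 hyΩ
    refine Node00.cover_mem_hullD_one_of_within (by omega) (y := lift (F.P Kt) y) (by rw [cover_lift]; exact hy1) fun κ => (hwithin κ).trans ?_
    have hpow : (F.P Kt).L ^ (n + 1) ≤ (F.P Kt).L ^ 2 := Nat.pow_le_pow_right hLpos (by omega)
    have := Nat.mul_le_mul_left (((F.P Kt).d + 4) * (F.P Kt).L + 6) hpow
    exact_mod_cast this.trans hM₁
  · -- `i ≥ 3`: the printed collar from a point of `Ω_{i−1}`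
    obtain ⟨n', rfl⟩ : ∃ n', n = n' + 2 := ⟨n - 2, by omega⟩
    have htop : Node00.topSeq (Node00.suppDomOfRecord F ν₀ Kt (maxDomT ν₀.M₁ Z)) (maxDomT ν₀.M₁ Z) (n' + 2 + 1 - 2) = maxDomT ν₀.M₁ Z (n' + 1) := by
      have h0 : n' + 2 + 1 - 2 = n' + 1 := by omega
      rw [h0]
      simp [Node00.topSeq]
    rw [htop]
    have hy1 : y ∈ maxDomT ν₀.M₁ Z (n' + 1 + 1) := maxDomT_antitone hM Z (by omega : n' + 1 + 1 ≤ n' + 2 + 1) hyΩ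
    refine dist_maxDomT hM hdiv (show n' + 1 + 1 ≤ k by omega) (x := lift (F.P Kt) y) (by rw [cover_lift]; exact hy1) fun κ => ?_
    rw [abs_sub_comm]
    refine (hwithin κ).trans ?_
    -- `((d+4)L+6)·L^{n'+3} + 1 ≤ L^{n'+2}·M₁`
    have key : (((F.P Kt).d + 4) * (F.P Kt).L + 6) * (F.P Kt).L ^ (n' + 2 + 1) + 1 ≤ (F.P Kt).L ^ (n' + 1 + 1) * ν₀.M₁ := by
      have hA : 0 < (((F.P Kt).d + 4) * (F.P Kt).L + 6) * (F.P Kt).L ^ (n' + 2 + 1) := by positivity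
      have hAL : (((F.P Kt).d + 4) * (F.P Kt).L + 6) * (F.P Kt).L ^ (n' + 2 + 1) * (F.P Kt).L ≤ (F.P Kt).L ^ (n' + 1 + 1) * ν₀.M₁ := by
        have : (((F.P Kt).d + 4) * (F.P Kt).L + 6) * (F.P Kt).L ^ (n' + 2 + 1) * (F.P Kt).L = (F.P Kt).L ^ (n' + 1 + 1) * ((((F.P Kt).d + 4) * (F.P Kt).L + 6) * (F.P Kt).L ^ 2) := by ring
        rw [this]; exact Nat.mul_le_mul_left _ hM₁
      nlinarith [hA, hAL, hL2]
    have key' : ((((((F.P Kt).d + 4) * (F.P Kt).L + 6) * (F.P Kt).L ^ (n' + 2 + 1) : ℕ) : ℤ)) + 1 ≤ ((side (F.P Kt).L ν₀.M₁ (n' + 1 + 1) : ℕ) : ℤ) := by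
      unfold side; exact_mod_cast key
    linarith

end Base

/-! ## §2 The family exists with all three clauses -/

section Exists

/-- ★★★ **THE SEGMENT PLAQUETTE FAMILY AT `𝐁_k(Z)` EXISTS** with dag-n11's downward box-closure below `i − 1`, its base in the class region two levels down, and the three-block plaquettes of every
segment bond inside — the geometry displayed by `N12IteratedPlaqLetterOfFamily`, discharged under `M₁ ≥ ((d+4)L+6)·L²` and cover divisibility (`k ≤ m + K`).
[cite: Balaban1985Averaging, Prop. 2 (52)–(53) p.26; Balaban1988Convergent, p.255, (2.13) pp.256–257; Balaban1987RG1, (0.1)–(0.3) pp.251–252] -/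
theorem exists_segmentPlaqFamily_Bj {F : T4Family} (ν₀ : Node00.Stage7Numerics) (Kt : ℕ) {k : ℕ} (hk : k ≤ (F.P Kt).m + (F.P Kt).K)
    (hM₁ : (((F.P Kt).d + 4) * (F.P Kt).L + 6) * (F.P Kt).L ^ 2 ≤ ν₀.M₁) (hdiv : side (F.P Kt).L ν₀.M₁ k ∣ (F.P Kt).sitesPerDir 0) (Z : Set (Site (F.P Kt) 0)) :
    ∃ Sfam : (i : ℕ) → PBond (F.P Kt) i → (j : ℕ) → Set (Plaq (F.P Kt) j),
      (∀ i, 1 ≤ i → i ≤ k → ∀ c ∈ bondsOf ((Bj ν₀.M₁ Z k : DetSet (F.P Kt)) i), ∀ j, j < i - 1 → ∀ p ∈ Sfam i c (j + 1),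
        (↑(boxRegion (emb p.src) (((F.P Kt).d + 4) * (F.P Kt).L + 2)) : Set (Plaq (F.P Kt) j)) ⊆ Sfam i c j) ∧
      (∀ i, 1 ≤ i → i ≤ k → ∀ c ∈ bondsOf ((Bj ν₀.M₁ Z k : DetSet (F.P Kt)) i),
        Sfam i c 0 ⊆ plaqsOf (Node00.topSeq (Node00.suppDomOfRecord F ν₀ Kt (maxDomT ν₀.M₁ Z)) (maxDomT ν₀.M₁ Z) (i - 2))) ∧
      (∀ i, 1 ≤ i → i ≤ k → ∀ c ∈ bondsOf ((Bj ν₀.M₁ Z k : DetSet (F.P Kt)) i), ∀ j < i, ∀ c' : PBond (F.P Kt) (j + 1), c'.dir = c.dir →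
        (∃ s < (F.P Kt).L ^ i, embIter (j + 1) c'.src = (fun z : Site (F.P Kt) 0 => z.shift c.dir)^[s] (embIter i c.src)) →
        ∀ q : Plaq (F.P Kt) j, (blockOf q.src = c'.src.unshift c'.dir ∨ blockOf q.src = c'.src ∨ blockOf q.src = c'.tgt) → q ∈ Sfam i c j) := by
  refine ⟨fun i c j => {q : Plaq (F.P Kt) j | ∀ ν, ∃ E : ℤ,
      |E| ≤ ((3 * (F.P Kt).L ^ i + (((F.P Kt).d + 4) * (F.P Kt).L + 2) * ∑ l ∈ Finset.Ico j i, (F.P Kt).L ^ l : ℕ) : ℤ) ∧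
      embIter j q.src ν = embIter i c.src ν + (E : ZMod ((F.P Kt).sitesPerDir 0))}, ?_, ?_, ?_⟩
  · intro i _ hik c _ j hj p hp q hq
    exact family_boxClosed (by omega) (hik.trans hk) _ (embIter i c.src) hp hq
  · intro i hi1 hik c hc q hq
    exact base_subset_topSeq ν₀ Kt hk hM₁ hdiv Z hi1 hik hc hq
  · intro i _ hik c _ j hj c' hdir hs q hq
    exact mem_family_of_threeBlocks hj (hik.trans hk) _ hdir hs hq

end Exists

/-! ## §3 The (σ)_N capstone modulo class, datum, region geometry and numerics -/

section Capstone

/-- ★★★ **(σ)_N AT THE RECORD MODULO CLASS, DATUM, REGION GEOMETRY AND NUMERICS.**  `N12IteratedPlaqLetterOfFamily.exists_gaugeLetterLoc_atRecord_of_class_of_family` with the family supplied by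
`exists_segmentPlaqFamily_Bj`.  RESIDUE: the minimiser in NODE 00's class (`hmin`), the region datum `W 𝒞 ρn` (`hD`), the region's geometry letters `hGN` ∕ `hN1` (dag-n12-w6's) and `hGmem` (member
shadows in `𝒞`), the tower budgets `θ`, and NUMERICS: `εreg` positive and small, no wrapping `hN`, radii `hRad`, `M₁ ≥ ((d+4)L+6)·L²`, `2 ≤ M₁`, cover divisibility.  Every plaquette estimate is read
off [15] (2) ∕ [6] (1.7) (the class) and [Balaban1985Averaging] Prop. 2 (dag-n11, local) by name.
[cite: Balaban1985Variational, (2)–(4) p.278, (16)–(18) p.280; Balaban1985RegularSpaces, (1.7) p.77, (1.19) p.79; Balaban1985Averaging, Prop. 2 (52)–(53) p.26; Balaban1988Convergent, (2.12)–(2.13) pp.256–257, (2.16) p.257, p.267] -/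
theorem exists_gaugeLetterLoc_atRecord_of_class_geometry {F : T4Family} (ν : Node00.Stage7Numerics) (Kt : ℕ) {k : ℕ} (hk0 : 0 < k) (hk : k ≤ (F.P Kt).m + (F.P Kt).K)
    (hM2 : 2 ≤ ν.M₁) (hdiv : side (F.P Kt).L ν.M₁ k ∣ (F.P Kt).sitesPerDir 0) (Z : Set (Site (F.P Kt) 0))
    -- no wrapping, at the caps `ℓ_k`, `m·L^k`
    (hN : 2 * (∑ i ∈ Finset.range (k + 1), ((F.P Kt).d * (((F.P Kt).L ^ i - 1) / 2) + 1)) + 1 +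
      (3 * ((F.P Kt).d * (((F.P Kt).L - 1) / 2)) + 5) * (F.P Kt).L ^ k < (F.P Kt).sitesPerDir 0)
    -- radius numerics: the level-`J` box fits the collar `L^{J−1}·M₁`
    (hRad : ∀ J, 1 ≤ J → J ≤ k →
      (2 * ∑ i ∈ Finset.range (J + 1 + 1), ((F.P Kt).d * (((F.P Kt).L ^ i - 1) / 2) + 1)) + 1 +
          (3 * ((F.P Kt).d * (((F.P Kt).L - 1) / 2)) + 5) * (F.P Kt).L ^ min (J + 1) k +
        (∑ i ∈ Finset.range (J + 1), ((F.P Kt).d * (((F.P Kt).L ^ i - 1) / 2) + 1)) + 3 ≤ (F.P Kt).L ^ (J - 1) * ν.M₁)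
    -- the region-normalised datum and the minimiser
    {ρn : ℝ} (hρn : 0 ≤ ρn)
    (W : GaugeField (F.P Kt) k SU2) (𝒞 : Set (PBond (F.P Kt) k)) (hD : ∀ c ∈ 𝒞, dist1 (W c) ≤ ρn)
    {U₀ : GaugeField (F.P Kt) 0 SU2}
    (hmin : IsMinimizer (Node00.avOfRecord F 2 Kt) (Node00.regMSCoPOfRecord F 2 ν Kt k (maxDomT ν.M₁ Z)) (Bj ν.M₁ Z k)
      (avgFamily (Node00.avOfRecord F 2 Kt) (qsstarGIter0 k W)) U₀)
    -- geometry of the neighbourhood (dag-n12-w6's letters, verbatim)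
    (N : Set (PBond (F.P Kt) 0))
    (hGN : ∀ b ∈ N, (b.src ∉ maxDomT ν.M₁ Z 1 ∨ b.tgt ∉ maxDomT ν.M₁ Z 1) → blockIter k b.tgt ≠ blockIter k b.src →
      (⟨blockIter k b.src, b.dir⟩ : PBond (F.P Kt) k) ∈ 𝒞)
    (hN1 : ∀ p : Plaq (F.P Kt) 0, ((⟨p.src, p.μ⟩ : PBond (F.P Kt) 0) ∈ {b : PBond (F.P Kt) 0 | b.src ∈ maxDomT ν.M₁ Z 1} ∨
        (⟨p.src.shift p.μ, p.ν⟩ : PBond (F.P Kt) 0) ∈ {b : PBond (F.P Kt) 0 | b.src ∈ maxDomT ν.M₁ Z 1} ∨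
        (⟨p.src.shift p.ν, p.μ⟩ : PBond (F.P Kt) 0) ∈ {b : PBond (F.P Kt) 0 | b.src ∈ maxDomT ν.M₁ Z 1} ∨
        (⟨p.src, p.ν⟩ : PBond (F.P Kt) 0) ∈ {b : PBond (F.P Kt) 0 | b.src ∈ maxDomT ν.M₁ Z 1}) →
      (⟨p.src, p.μ⟩ : PBond (F.P Kt) 0) ∈ N ∧ (⟨p.src.shift p.μ, p.ν⟩ : PBond (F.P Kt) 0) ∈ N ∧
        (⟨p.src.shift p.ν, p.μ⟩ : PBond (F.P Kt) 0) ∈ N ∧ (⟨p.src, p.ν⟩ : PBond (F.P Kt) 0) ∈ N)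
    -- the class threshold `εreg`: positive and small ([Balaban1985Averaging] Prop. 2's smallness at `α₀ := εreg·L²`)
    (hεpos : 0 < ν.εreg)
    (hα3 : (143 * (((((F.P Kt).d + 4 : ℕ) : ℝ)) ^ 2 / 4) ^ 2) * (ν.εreg * (F.P Kt).L ^ 2) ≤ 1 / 3)
    (hα2 : 2 * (ν.εreg * (F.P Kt).L ^ 2) ≤ 2 * deltaSU (Fin 2) / ((((F.P Kt).d + 4) * (F.P Kt).L : ℕ) : ℝ) ^ 2)
    (haN : (((((F.P Kt).d + 2) * (F.P Kt).L : ℕ) : ℝ) ^ 2 / 4) * (2 * (ν.εreg * (F.P Kt).L ^ 2)) < deltaSU (Fin 2))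
    -- the tower budgets `θ` fed by the constant plaquette bound `a := 2·εreg·L²`
    (θ : ℕ → ℝ) (hθ0 : 0 ≤ θ 0)
    (hθ : ∀ j, 6 * ((((((F.P Kt).d + 2) * (F.P Kt).L : ℕ) : ℝ) ^ 2 / 4) * (2 * (ν.εreg * (F.P Kt).L ^ 2))) + (F.P Kt).L * θ j ≤ θ (j + 1))
    -- the family's support numerics: `M₁ ≥ ((d+4)L + 6)·L²`
    (hM₁ : (((F.P Kt).d + 4) * (F.P Kt).L + 6) * (F.P Kt).L ^ 2 ≤ ν.M₁)
    -- GEOMETRY instead of the datum letter: the `k`-shadows of the face-crossing members of `𝐁_k(Z)` lie in `𝒞`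
    (hGmem : ∀ i ≤ k, ∀ c ∈ bondsOf ((Bj ν.M₁ Z k : DetSet (F.P Kt)) i), blockIter k (embIter i c.tgt) ≠ blockIter k (embIter i c.src) →
      (⟨blockIter k (embIter i c.src), c.dir⟩ : PBond (F.P Kt) k) ∈ 𝒞) :
    ∃ σ : GaugeTransf (F.P Kt) 0 SU2,
      (∀ j, j ≤ k → ∀ b ∈ bondsOf (Bj ν.M₁ Z k j), toMS σ j b.src = 1 ∧ toMS σ j b.tgt = 1) ∧
        (∀ p : Plaq (F.P Kt) 0, ((⟨p.src, p.μ⟩ : PBond (F.P Kt) 0) ∈ {b : PBond (F.P Kt) 0 | b.src ∈ maxDomT ν.M₁ Z 1} ∨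
            (⟨p.src.shift p.μ, p.ν⟩ : PBond (F.P Kt) 0) ∈ {b : PBond (F.P Kt) 0 | b.src ∈ maxDomT ν.M₁ Z 1} ∨
            (⟨p.src.shift p.ν, p.μ⟩ : PBond (F.P Kt) 0) ∈ {b : PBond (F.P Kt) 0 | b.src ∈ maxDomT ν.M₁ Z 1} ∨
            (⟨p.src, p.ν⟩ : PBond (F.P Kt) 0) ∈ {b : PBond (F.P Kt) 0 | b.src ∈ maxDomT ν.M₁ Z 1}) →
          ‖((gaugeAct σ U₀ ⟨p.src, p.μ⟩ : SU2) : Matrix (Fin 2) (Fin 2) ℂ) - 1‖ ≤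
              max ρn ((((2 * (∑ i ∈ Finset.range (k + 1), ((F.P Kt).d * (((F.P Kt).L ^ i - 1) / 2) + 1)) + 1 +
                  (3 * ((F.P Kt).d * (((F.P Kt).L - 1) / 2)) + 5) * (F.P Kt).L ^ k : ℕ) : ℝ)) ^ 2 / 4 * (ν.εreg * (F.P Kt).eta 0 ^ 2) +
                ((3 * ((F.P Kt).d * (((F.P Kt).L - 1) / 2)) + 5 : ℕ) : ℝ) * θ k + ((3 * ((F.P Kt).d * (((F.P Kt).L - 1) / 2)) + 5 : ℕ) : ℝ) * ρn) ∧
            ‖((gaugeAct σ U₀ ⟨p.src.shift p.μ, p.ν⟩ : SU2) : Matrix (Fin 2) (Fin 2) ℂ) - 1‖ ≤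
              max ρn ((((2 * (∑ i ∈ Finset.range (k + 1), ((F.P Kt).d * (((F.P Kt).L ^ i - 1) / 2) + 1)) + 1 +
                  (3 * ((F.P Kt).d * (((F.P Kt).L - 1) / 2)) + 5) * (F.P Kt).L ^ k : ℕ) : ℝ)) ^ 2 / 4 * (ν.εreg * (F.P Kt).eta 0 ^ 2) +
                ((3 * ((F.P Kt).d * (((F.P Kt).L - 1) / 2)) + 5 : ℕ) : ℝ) * θ k + ((3 * ((F.P Kt).d * (((F.P Kt).L - 1) / 2)) + 5 : ℕ) : ℝ) * ρn) ∧
            ‖((gaugeAct σ U₀ ⟨p.src.shift p.ν, p.μ⟩ : SU2) : Matrix (Fin 2) (Fin 2) ℂ) - 1‖ ≤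
              max ρn ((((2 * (∑ i ∈ Finset.range (k + 1), ((F.P Kt).d * (((F.P Kt).L ^ i - 1) / 2) + 1)) + 1 +
                  (3 * ((F.P Kt).d * (((F.P Kt).L - 1) / 2)) + 5) * (F.P Kt).L ^ k : ℕ) : ℝ)) ^ 2 / 4 * (ν.εreg * (F.P Kt).eta 0 ^ 2) +
                ((3 * ((F.P Kt).d * (((F.P Kt).L - 1) / 2)) + 5 : ℕ) : ℝ) * θ k + ((3 * ((F.P Kt).d * (((F.P Kt).L - 1) / 2)) + 5 : ℕ) : ℝ) * ρn) ∧
            ‖((gaugeAct σ U₀ ⟨p.src, p.ν⟩ : SU2) : Matrix (Fin 2) (Fin 2) ℂ) - 1‖ ≤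
              max ρn ((((2 * (∑ i ∈ Finset.range (k + 1), ((F.P Kt).d * (((F.P Kt).L ^ i - 1) / 2) + 1)) + 1 +
                  (3 * ((F.P Kt).d * (((F.P Kt).L - 1) / 2)) + 5) * (F.P Kt).L ^ k : ℕ) : ℝ)) ^ 2 / 4 * (ν.εreg * (F.P Kt).eta 0 ^ 2) +
                ((3 * ((F.P Kt).d * (((F.P Kt).L - 1) / 2)) + 5 : ℕ) : ℝ) * θ k + ((3 * ((F.P Kt).d * (((F.P Kt).L - 1) / 2)) + 5 : ℕ) : ℝ) * ρn)) ∧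
        (∀ b ∈ inputs (Bj ν.M₁ Z k), b ∈ N →
          ‖((gaugeAct σ U₀ b : SU2) : Matrix (Fin 2) (Fin 2) ℂ) - 1‖ ≤
              max ρn ((((2 * (∑ i ∈ Finset.range (k + 1), ((F.P Kt).d * (((F.P Kt).L ^ i - 1) / 2) + 1)) + 1 +
                  (3 * ((F.P Kt).d * (((F.P Kt).L - 1) / 2)) + 5) * (F.P Kt).L ^ k : ℕ) : ℝ)) ^ 2 / 4 * (ν.εreg * (F.P Kt).eta 0 ^ 2) +
                ((3 * ((F.P Kt).d * (((F.P Kt).L - 1) / 2)) + 5 : ℕ) : ℝ) * θ k + ((3 * ((F.P Kt).d * (((F.P Kt).L - 1) / 2)) + 5 : ℕ) : ℝ) * ρn)) := by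
  obtain ⟨Sfam, h1, h2, h3⟩ := exists_segmentPlaqFamily_Bj ν Kt hk hM₁ hdiv Z
  exact exists_gaugeLetterLoc_atRecord_of_class_of_family ν Kt hk0 hk hM2 hdiv Z hN hRad hρn W 𝒞 hD hmin N hGN hN1 hεpos hα3 hα2 haN θ hθ0 hθ
    Sfam h1 h2 h3 hGmem

end Capstone

end Summit.QuantumFields.YangMills.BalabanUVNodes.N12SegmentPlaqFamilyAtRecord

end
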